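import Summits.Ventures.HSemireg.UntwistCocycleTwistHom
import Literature.AlgebraicGeometry.Modules.RankOneCocycle
import Literature.AlgebraicGeometry.Modules.LineBundleOfCocycleClass
import Mathlib.LinearAlgebra.Matrix.Determinant.Basic
import HarnessLib

/-!
# Venture HSemireg — route R1.0 (ii) on real carriers: RANK and DETERMINANT CLASS of the cocycle twist,
# `rk(E ⊗ M) = rk E` and `det(E ⊗ M) = M^{⊗ r} ⊗ det E` in `Ȟ¹(X, 𝒪_X^×)` (th-4 file #18; sequel of #14, #15, #16)

HONEST FRAMING. Module-level algebra on the tree's real carriers (`Modules/FrameTransition`, `Modules/DeterminantCocycle`: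
frames, transition matrices, the determinant cocycle and the Čech Picard group `CechPic X = Ȟ¹(X, 𝒪_X^×)`) for the
CONSTRUCTED cocycle twist `E ↦ E⟨c⟩ = E ⊗ M`, `M = lineBundle c` (files #11–#15). Nothing about any variety; no gerbe;
nothing here says HC, HC_CM or HC_AV is proved.

WHY (the «which class» clause of R1.0 (ii)). `UntwistKappaClass.lean` (#2) does the class bookkeeping of `E ↦ E ⊗ L` in an
abstract commutative ℚ-algebra from the DICTIONARY `c₁(E ⊗ L) = c₁(E) + r • c₁(L)`, `ch(E ⊗ L) = ch(E) · exp(c₁ L)` (a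
hypothesis there; `UntwistSigmaMultiplier.trace_leibniz_degree_one` derives the degree-one line from the abstract
Leibniz rule), and red-4 R4-11(α)/ref-2 (R2) record that this dictionary is «not wired» to the constructed twist. This
file wires its two lowest rows to real carriers, for every scheme `X`, every cocycle `c` and every finite locally free
`E` of constant rank `r`:

* `hasRank_twist` — **`rk(E ⊗ M) = rk E`** (`HasRank E r → HasRank (twist c E) r`; the `ch₀` row);
* `detClass_twist` — **`det(E ⊗ M) = [c]^r · det(E)`** in `CechPic X` (`detClass` of `Modules/DeterminantCocycle.lean`),
  verbatim Gunning's «`det(ξ ⊗ Φ) = ξ^m · det Φ`» for the determinant line bundle DEFINED as the class of the cocycle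
  `(det Φ_{αβ}) ∈ Z¹(𝔘, 𝒪^*)` ([Gunning1967] §4, PDF p. 54 — printed for Riemann surfaces; the cocycle algebra is base-free
  and is what is proved here for any scheme); one functor `c₁ : Pic X → A¹X` away (Fulton Ex. 15.3.6) this is the
  `c₁` row `c₁(E ⊗ L) = c₁(E) + r · c₁(L)` of Fulton Example 3.2.2; with `detClass_twist_lineBundle`:
  `det(lineBundle c′ ⊗ M_c) = [c] · [c′]`;
* `prod_detClass_twist_zpow` — the K-CLASS FORM `∏ det(K_i ⊗ M)^{ε_i} = [c]^{Σ ε_i r_i} · ∏ det(K_i)^{ε_i}` (terms `K_i` of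
  ranks `r_i`, integer multiplicities `ε_i`; for the terms of the two-term complex `E₀` with `ε_i = (-1)^i` the exponent is
  `Σ ε_i r_i = rk E₀ = -2`, the `r` of file #2).

MECHANISM (all in namespace `CocycleTwist`): `powCocycle c r = (U_x, g_{xy}^r)` with `mk_powCocycle : [g^r] = [c]^r`;
`refineFrameSystem` (frames of `E` restricted below the cover of `c`); `twistFrameSystem` — the frames `b_i ⊗ t_x` of
`E ⊗ M` (a frame `b_i` of `E` over `U_x ⊆ U^c_x` followed by `twistTrivOver` of file #14); the transition matrices of the
twisted frames are `T(b ⊗ t_x, b′ ⊗ t_y) = g_{xy} · T(b, b′)` (`transition_trans_twistTrivOver`, from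
`(e ⊗ t_y)_x = g_{xy} e`), so their determinants are `g_{xy}^r · det T` (`Matrix.det_smul`;
`cocycle_g_twistFrameSystem`), i.e. the determinant cocycle of `E ⊗ M` is the product cocycle `g^r · det T`
(`mk_cocycle_twistFrameSystem`), and `detClass` may be computed in any frame system (`detClass_eq_mk`).

Numbers (g = 4 anchor, by value; R1.0 (ii)): `c₁(M_B) = B = c₁(P)/2` (m even) and `c₁(E ⊗ M_B) = c₁(E) + r·B` for each
finite locally free `E` of rank `r`; for the two-term complex `E₀` of the cell (K-class of rank `−2`, file #2
`twist_ch_eq_kappa_rank_neg_two`) the statement here applies to each TERM, the complex-level `c₁` being the alternating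
sum over the terms (not formed on these carriers). Which twist: `- ⊗ M_B`, `M_B = lineBundle c` (#15). What stays
declared: the rows of degree `≥ 2` of `ch(E ⊗ M) = ch(E) · exp(c₁ M)` (no Chern character beyond `rk`/`det` on these
carriers), and everything gerbe-side.

## References

* R. C. Gunning, *Lectures on Vector Bundles over Riemann Surfaces*, Princeton Math. Notes 6 (1967), §4 ¶1 (PDF p. 54
  of the held copy): `det Φ := [(det Φ_{αβ})]`, `det(Φ₁ ⊗ Φ₂) = (det Φ₁)^{m₂} (det Φ₂)^{m₁}`, `det(ξ ⊗ Φ) = ξ^m det Φ`.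
  [Gunning1967]
* W. Fulton, *Intersection theory*, 2nd ed. (1998), Example 3.2.2 (`c_p(E ⊗ L)`; `p = 1`: `c₁(E ⊗ L) = c₁(E) + r c₁(L)`),
  Ex. 15.3.6 (`Pic X = A¹X`), B.3.1–B.3.3, B.3.6 (bundles by transition functions; rank per connected component).
  [Fulton1998]
* R. Hartshorne, *Algebraic Geometry*, GTM 52 (1977), III Ex. 4.5 (`Pic X ≅ H¹(X, 𝒪_X^*)` via the transition cocycle),
  II Ex. 5.16 (exterior powers of locally free sheaves), II Ex. 6.11 (b) (`det` of a two-term locally free resolution,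
  for the remark on the complex `E₀`). [Hartshorne1977]
-/

noncomputable section

open CategoryTheory AlgebraicGeometry Opposite TopologicalSpace

namespace Summit.Ventures.HSemireg

open Literature.AlgebraicGeometry.Modules Literature.AlgebraicGeometry.Motives

namespace CocycleTwist

universe u

variable {X : Scheme.{u}} (c : UnitCocycle X) {E : X.Modules}

/-! ### The power cocycle `g^r` and its class `[c]^r` -/

/-- The cocycle `(U_x, g_{xy}^r)` — the transition functions of `M^{⊗ r}`, `M = lineBundle c`. [folklore] -/
def powCocycle (c : UnitCocycle X) (r : ℕ) : UnitCocycle X where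
  U := c.U
  mem := c.mem
  g x y V hx hy := c.g x y V hx hy ^ r
  map_g x y V V' hx hy i := by rw [map_pow, c.map_g]
  g_mul x y z V hx hy hz := by rw [← mul_pow, c.g_mul]
  g_self x V hx := by rw [c.g_self, one_pow]

/-- `[(U_x, g^r)] = [c]^r` in `Ȟ¹(X, 𝒪_X^×)`. [folklore] -/
theorem mk_powCocycle (r : ℕ) : CechPic.mk (powCocycle c r) = CechPic.mk c ^ r := by
  induction r with
  | zero =>
    rw [pow_zero, ← CechPic.mk_one]
    exact CechPic.sound (UnitCocycle.equiv_of_eq _ _ c.U c.mem (fun _ => le_rfl) (fun _ => le_top)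
      fun x y V hx hy => (pow_zero _).symm)
  | succ r ih =>
    rw [pow_succ, ← ih, ← CechPic.mk_mul]
    exact CechPic.sound (UnitCocycle.equiv_of_eq _ _ c.U c.mem (fun _ => le_rfl) (fun _ => le_inf le_rfl le_rfl)
      fun x y V hx hy => (pow_succ _ _).symm)

/-! ### Frame systems subordinate to the cover of the cocycle, and the twisted frame system -/

variable (E) in
/-- Refining a frame system of `E` by the cover of `c`: frames restricted to `U_x ∩ U^c_x`. [folklore] -/
def refineFrameSystem (F : FrameSystem E) : FrameSystem E where
  U x := F.U x ⊓ c.U x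
  mem x := ⟨F.mem x, c.mem x⟩
  I := F.I
  rank := F.rank
  enum := F.enum
  frame x := SheafOfModules.restrictTrivialisation (R := X.ringCatSheaf) (homOfLE (inf_le_left : F.U x ⊓ c.U x ≤ F.U x))
    (F.frame x)

/-- The refined frame system is subordinate to the cover of `c`. [folklore] -/
theorem refineFrameSystem_U_le (F : FrameSystem E) (x : X) : (refineFrameSystem c E F).U x ≤ c.U x := inf_le_right

/-- The refined frame system has the same ranks. [folklore] -/
theorem refineFrameSystem_rank (F : FrameSystem E) (x : X) : (refineFrameSystem c E F).rank x = F.rank x := rfl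

variable (E) in
/-- **The twisted frame system** of `E⟨c⟩ = E ⊗ M`: over `U_x ⊆ U^c_x` the frame `b_i ⊗ t_x` (the frame `b_i` of `E` followed
by the local trivialisation `twistTrivOver` of file #14). [folklore] -/
def twistFrameSystem (F : FrameSystem E) (hF : ∀ x, F.U x ≤ c.U x) : FrameSystem (twist c E) where
  U := F.U
  mem := F.mem
  I := F.I
  rank := F.rank
  enum := F.enum
  frame x := F.frame x ≪≫ twistTrivOver c E x (F.U x) (hF x)

/-- The `x`-coordinate of `e ⊗ t_y` over `V ⊆ U_x ∩ U_y` is `g_{xy} · e`. [folklore] -/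
theorem appLE_twistTrivOver_inv_trivSection' (x y : X) {W V : X.Opens} (hW : W ≤ c.U x) (k : V ⟶ W) (hV : V ≤ c.U y)
    (e : Γ(E, V)) :
    appLE (twistTrivOver c E x W hW).inv k (trivSection c E y hV e) = c.g x y V (k.le.trans hW) hV • e := by
  rw [show (twistTrivOver c E x W hW).inv = ofTwistOver c E x W hW from rfl, appLE_ofTwistOver, comp_trivSection,
    Scheme.Modules.map_smul, map_g_apply, presheaf_map_map,
    Subsingleton.elim (homOfLE (le_inf le_rfl (k.le.trans hW) : V ≤ V ⊓ c.U x) ≫ homOfLE (inf_le_left : V ⊓ c.U x ≤ V))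
      (𝟙 V), presheaf_map_id]

/-- **Transition matrices of twisted frames**: for frames `f` of `E` over `W ⊆ U_x` and `f′` over `W′ ⊆ U_y`,
`T(f ⊗ t_x, f′ ⊗ t_y) = g_{xy} · T(f, f′)` over any `V` below both. [folklore] -/
theorem transition_trans_twistTrivOver {W W' V : X.Opens} {I I' : Type u} (f : SheafOfModules.free I ≅ E.over W)
    (f' : SheafOfModules.free I' ≅ E.over W') (x y : X) (hW : W ≤ c.U x) (hW' : W' ≤ c.U y) (k : V ⟶ W) (k' : V ⟶ W') :
    transition (f ≪≫ twistTrivOver c E x W hW) (f' ≪≫ twistTrivOver c E y W' hW') k k' =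
      c.g x y V (k.le.trans hW) (k'.le.trans hW') • transition f f' k k' := by
  ext i j
  rw [Matrix.smul_apply, transition_apply, transition_apply, coord_def, coord_def, dualBasis_trans_over,
    basisSection_trans_over, appLE_comp, show (twistTrivOver c E y W' hW').hom = toTwistOver c E y W' hW' from rfl,
    appLE_toTwistOver, trivSection_map, appLE_twistTrivOver_inv_trivSection', appLE_smul_right]
  rfl

/-- **Determinant cocycle of the twisted frames**: `det T′ = g_{xy}^r · det T` for frames of constant rank `r`. [folklore] -/
theorem cocycle_g_twistFrameSystem (F : FrameSystem E) (hF : ∀ x, F.U x ≤ c.U x) {r : ℕ} (hr : ∀ x, F.rank x = r)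
    (x y : X) (V : X.Opens) (hx : V ≤ F.U x) (hy : V ≤ F.U y) :
    (twistFrameSystem c E F hF).cocycle.g x y V hx hy =
      c.g x y V (hx.trans (hF x)) (hy.trans (hF y)) ^ r * F.cocycle.g x y V hx hy := by
  have h : F.rank x = F.rank y := (hr x).trans (hr y).symm
  rw [FrameSystem.cocycle_g, FrameSystem.cocycle_g]
  change transitionDet (F.frame x ≪≫ twistTrivOver c E x (F.U x) (hF x)) (F.frame y ≪≫ twistTrivOver c E y (F.U y) (hF y))
      (F.enum x) (F.enum y) (homOfLE hx) (homOfLE hy) =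
    c.g x y V (hx.trans (hF x)) (hy.trans (hF y)) ^ r *
      transitionDet (F.frame x) (F.frame y) (F.enum x) (F.enum y) (homOfLE hx) (homOfLE hy)
  rw [transitionDet_of_eq _ _ _ _ h, transitionDet_of_eq _ _ _ _ h]
  have hM : (Matrix.of fun a b : Fin (F.rank x) =>
      stdTransition (F.frame x ≪≫ twistTrivOver c E x (F.U x) (hF x)) (F.frame y ≪≫ twistTrivOver c E y (F.U y) (hF y))
        (F.enum x) (F.enum y) (homOfLE hx) (homOfLE hy) a (Fin.cast h b)) =
      c.g x y V (hx.trans (hF x)) (hy.trans (hF y)) •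
        Matrix.of fun a b : Fin (F.rank x) => stdTransition (F.frame x) (F.frame y) (F.enum x) (F.enum y)
          (homOfLE hx) (homOfLE hy) a (Fin.cast h b) := by
    ext a b
    rw [Matrix.smul_apply, Matrix.of_apply, Matrix.of_apply, stdTransition_apply, stdTransition_apply,
      transition_trans_twistTrivOver, Matrix.smul_apply]
  rw [hM, Matrix.det_smul, Fintype.card_fin]
  exact congrArg (fun n : ℕ => c.g x y V (hx.trans (hF x)) (hy.trans (hF y)) ^ n * _) (hr x)

/-- The determinant cocycle of the twisted frames is `g^r · det T` as a cocycle (on the cover `U_x`). [folklore] -/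
theorem mk_cocycle_twistFrameSystem (F : FrameSystem E) (hF : ∀ x, F.U x ≤ c.U x) {r : ℕ} (hr : ∀ x, F.rank x = r) :
    CechPic.mk (twistFrameSystem c E F hF).cocycle = CechPic.mk c ^ r * CechPic.mk F.cocycle := by
  rw [← mk_powCocycle, ← CechPic.mk_mul]
  refine CechPic.sound (UnitCocycle.equiv_of_eq _ _ F.U F.mem (fun _ => le_rfl) (fun x => le_inf (hF x) le_rfl)
    fun x y V hx hy => ?_)
  exact (cocycle_g_twistFrameSystem c F hF hr x y V hx hy).symm

/-! ### Rank and determinant class of `E ⊗ M` -/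

/-- **`E ⊗ M` has rank `r` if `E` has** (`ch_0`: `rk(E ⊗ M) = rk E`; the frames `b_i ⊗ t_x`). [folklore] -/
theorem hasRank_twist {r : ℕ} (hE : HasRank E r) : HasRank (twist c E) r := by
  obtain ⟨F, hF⟩ := exists_frameSystem_of_hasRank hE
  exact (twistFrameSystem c E (refineFrameSystem c E F) (refineFrameSystem_U_le c F)).hasRank r hF

/-- **`det(E ⊗ M) = M^{⊗ r} ⊗ det E`** in `Ȟ¹(X, 𝒪_X^×)` for `E` finite locally free of rank `r` and `M = lineBundle c`
(Gunning: «`det(ξ ⊗ Φ) = ξ^m · det Φ`», `det` the class of the cocycle of determinants of transition matrices; under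
`c₁ : Pic → A¹` the degree-one row `c₁(E ⊗ M) = c₁(E) + r · c₁(M)` of `ch(E ⊗ M) = ch(E) · exp(c₁(M))`, Fulton Ex. 3.2.2).
[cite: Gunning1967, §4 (PDF p. 54: det(ξ ⊗ Φ) = ξ^m det Φ)] -/
theorem detClass_twist (hE : IsFiniteLocallyFree E) {r : ℕ} (hr : HasRank E r) :
    detClass (isFiniteLocallyFree_twist c hE) = CechPic.mk c ^ r * detClass hE := by
  obtain ⟨F₀, hF₀⟩ := exists_frameSystem_of_hasRank hr
  rw [detClass_eq_mk hE (refineFrameSystem c E F₀),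
    detClass_eq_mk (isFiniteLocallyFree_twist c hE)
      (twistFrameSystem c E (refineFrameSystem c E F₀) (refineFrameSystem_U_le c F₀))]
  exact mk_cocycle_twistFrameSystem c _ _ hF₀

/-- **`lineBundle c′ ⊗ M_c` has class `[c] · [c′]`** (rank one). [cite: Hartshorne1977, III Ex. 4.5] -/
theorem detClass_twist_lineBundle (c' : UnitCocycle X) :
    detClass (isFiniteLocallyFree_twist c c'.isFiniteLocallyFree_lineBundle) = CechPic.mk c * CechPic.mk c' := by
  rw [detClass_twist c c'.isFiniteLocallyFree_lineBundle c'.hasRank_lineBundle, pow_one, UnitCocycle.detClass_lineBundle]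

/-! ### The K-class form: alternating products over the terms of a bounded complex -/

/-- **K-class form of `det(E ⊗ M) = [c]^r · det E`**: for finitely many finite locally free modules `K_i` of ranks `r_i`
and integer multiplicities `ε_i` (intended: the terms of a strictly perfect complex with `ε_i = (-1)^i`, e.g. the two-term
`E₀` of the `g = 4` anchor with `Σ ε_i r_i = -2`), `∏ det(K_i ⊗ M)^{ε_i} = [c]^{Σ ε_i r_i} · ∏ det(K_i)^{ε_i}` in `CechPic X`
— i.e. `c₁((⊕ ε_i K_i) ⊗ M) = c₁ + (Σ ε_i r_i) · c₁(M)` for the K-class, the `r = rk` of `UntwistKappaClass` allowed to be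
negative. [cite: Gunning1967, §4 (PDF p. 54); Hartshorne1977, II Ex. 6.11 (b) (det of a two-term resolution)] -/
theorem prod_detClass_twist_zpow {ι : Type*} (s : Finset ι) {K : ι → X.Modules} (hK : ∀ i, IsFiniteLocallyFree (K i))
    {r : ι → ℕ} (hr : ∀ i, HasRank (K i) (r i)) (ε : ι → ℤ) :
    ∏ i ∈ s, detClass (isFiniteLocallyFree_twist c (hK i)) ^ ε i =
      CechPic.mk c ^ (∑ i ∈ s, (r i : ℤ) * ε i) * ∏ i ∈ s, detClass (hK i) ^ ε i := by
  classical
  induction s using Finset.induction_on with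
  | empty => rw [Finset.prod_empty, Finset.prod_empty, Finset.sum_empty, zpow_zero, one_mul]
  | insert i s hi ih =>
    rw [Finset.prod_insert hi, Finset.prod_insert hi, Finset.sum_insert hi, ih, detClass_twist c (hK i) (hr i), mul_zpow,
      ← zpow_natCast, ← zpow_mul, zpow_add, mul_mul_mul_comm]

end CocycleTwist

end Summit.Ventures.HSemireg

end
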